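/-
Copyright (c) 2026 the pub-hodgecm-mathlib formalisation cell (harness21).  Prover seat hodgecm-mathlib-R90-C133-p02 (g2), Track B ∕ R90-TF, h413 = `stmt-HodgeConjecture-24833`,
R90-TF section S8 «ContSpec-n½» (S8 dealer R90-CS-plan (g3) S8-R213 (a) «(T_f) GO HYPOTHESIS-FIRST»; census `R90/S8/CENSUS-hTRANS-payer.R90-C133-p02-g2.md` 8d98775fd52c510b
item 2): the FINITE-ADELIC half of the invariance letter `hTRANSτ` of ★ p864333 — FILE B, the ANALYTIC CORE: if the translated flat family `z ↦ r(g)·flat(φ, z)` of a τ-admissible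
generator re-expands as a FINITE combination `Σᵢ cᵢ^z · flat(ψᵢ, z)` of flat families of τ-admissible sections each of which carries continuation data (ESTATE T's exports), then
`R(g) f = Σᵢ cᵢ^{3/2} fᵢ` lies in the span of the τ-admissible generators.  (FILE A — the re-expansion itself from the height cocycle — follows K2E1-p14 (g4)'s lemma.)
-/
import Summits.HodgeConjecture.HodgeConjecture.Theorems.R90S8ResGMidBlockDiscreteOfTauRecordU3   -- ★ p864333; brings ★ p864252 `hSUM_holds`, ★ p863205 (`eqOn_reSlit_of_eqOn_re_gt`, `poleLetter_apply_eq_of_frequently_eq`, `frequently_nhdsNE_re_gt_im_pos`, `midPoleLetter_apply_quotientSubgroup_mul`), ★ τ-DEFS, ★ D1, ★ `eisensteinSeriesU_rightTranslation`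
import HarnessLib

/-!
# S8 (R)′ road, letter `hTRANSτ` step (T_f) FILE B — `R90S8ResGMidAtomTransOfFlatReexpansionU3`: TRANSLATES OF RESIDUE CLASSES ALONG A FINITE FLAT RE-EXPANSION — `R(g) f = Σᵢ cᵢ^{3/2} fᵢ`

Track B ∕ R90-TF, crux h413 = `stmt-HodgeConjecture-24833`, route of record `HCCMUnconditional`; cell `hodgecm-mathlib`, R90-TF section S8 «ContSpec-n½ ∕ ResidualSpectrum», socket (R)
(B ED. 7 :337) ← ★ `res_midBlock_le_residual_of_letters' (hDISC) …` ← ★ p864333 `hDISC_of_tauRecord (hW1) (hTRANSτ)` ← `hTRANSτ` = (T_f) [THIS FILE B + FILE A] + (T_∞) [ARCH-INV, L].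
THEOREMS ONLY (no `def`, no `instance`, no `notation`, no named-fact hypothesis, no `sorry`; default heartbeats); lane `--supports stmt-HodgeConjecture-24833 --as helper`
(count-neutral).  CLOSES NO SOCKET.  Visible inputs, all as BINDERS: the re-expansion `hdec` (FILE A: from the height cocycle `H(xg)∕H(x)` finitely-valued, K2E1-p14 (g4)), and the
continuation data of the pieces `ψᵢ` (ESTATE T's exports `hEXPτ`).  `μω` unitary (`hμu`, the frame's binder) feeds ★ `hSUM_holds`.

THE MATHEMATICS ([MoeglinWaldspurger1995] II.1.5, IV.1.11, V.3.13; [Conway1978] IV §3).  Let `(φ, f)` be a generator with data `(Ec, Sp, Fp)` and suppose POINTWISE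
`flat(φ, z)(x g) = Σᵢ cᵢ^z flat(ψᵢ, z)(x)` (`cᵢ > 0`) with `ψᵢ` τ-admissible at `U₁` carrying data `(Ecᵢ, Spᵢ, Fpᵢ, fᵢ)`.  For `2 < Re z`: `Ec z (x g) = E(flat(φ,z))(xg) =
E(r(g) flat(φ,z))(x)` (★ `eisensteinSeriesU_rightTranslation`) `= Σᵢ cᵢ^z E(flat(ψᵢ,z))(x)` (linearity, ★ Godement summability `hSUM_holds`) `= Σᵢ cᵢ^z Ecᵢ z x`; both sides are
holomorphic on the slit half-plane `{1 < Re} ∖ (Sp ∪ ⋃ Spᵢ)` (real finite slits), so they agree there (★ `eqOn_reSlit_of_eqOn_re_gt`); the pole letters `Fp(xg)` and `Σᵢ cᵢ^z Fpᵢ x` are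
analytic at `3/2` and equal `(z − 3/2)·(…)` of two functions agreeing frequently near `3/2`, hence `Fp (x g) (3/2) = Σᵢ cᵢ^{3/2} Fpᵢ x (3/2)` (★ `poleLetter_apply_eq_of_frequently_eq`); and
`R(g) f` is a.e. `x ↦ Fp((out x)⁻¹ g)(3/2)` (★ `rightRegular_apply_coeFn`, ★ `quotFun_rightTranslation`, left-`G(F)`-invariance ★ `midPoleLetter_apply_quotientSubgroup_mul`), so
`R(g) f = Σᵢ cᵢ^{3/2} fᵢ ∈ span G_τ`.
* §1 `eisensteinSeriesU_finset_sum` (finite linearity of the Eisenstein sum), `coeFn_finset_sum_smul_ae` (`L²` classes of finite combinations).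
* §2 **`midPoleLetter_translate_eq_sum`** (the pointwise residue identity `Fp (x g) (3/2) = Σᵢ cᵢ^{3/2} Fpᵢ x (3/2)`),
  **`rightRegular_apply_eq_sum_of_flatReexpansion`** (`R(g) f = Σᵢ cᵢ^{3/2} • fᵢ`), **`rightRegular_apply_mem_span_tauGenerators_of_flatReexpansion`** (`∈ span G_τ`).
HONEST LABEL: HC_CM is proved only modulo the 7 printed citations (2 remaining named inputs: hLiu418 = `stmt-HodgeConjecture-24832`, h413 = `stmt-HodgeConjecture-24833`) until
rung 0 closes; REL ≠ ★ ≠ BUILT; (T_f) = THIS ★-able core ∘ {FILE A re-expansion (p14's cocycle), `hEXPτ` (ESTATE T)}; (T_∞) L; pays no socket; count-neutral.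

## References
* [MoeglinWaldspurger1995] C. Mœglin, J.-L. Waldspurger, *Spectral Decomposition and Eisenstein Series* (1995), II.1.5, IV.1.11, V.3.13.
* [Conway1978] J. B. Conway, *Functions of One Complex Variable*, 2nd ed., GTM 11 (1978), IV §3.
-/

set_option autoImplicit false
set_option linter.dupNamespace false  -- the mandated namespace `…HodgeConjecture.HodgeConjecture.R90.S8` (LEAD #1 L1) repeats the summit's segment

noncomputable section

open MeasureTheory Measure Set Filter Topology NumberField ContRepresentation
open Literature.NumberTheory Literature.NumberTheory.Automorphic Literature.NumberTheory.Automorphic.UnitaryGroup Literature.NumberTheory.GaloisRepresentations AdelicGroupData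
open Literature.NumberTheory.Automorphic.Arthur2013.Leaves.TECR Literature.NumberTheory.Rogawski1990
open Summit.HodgeConjecture.HodgeConjecture.Cruxes.H413.K2E1BorelEisensteinU
open Summit.HodgeConjecture.HodgeConjecture.Cruxes.H413.K2E1CharacterEisensteinU3PairDefs
open Summit.HodgeConjecture.HodgeConjecture.Cruxes.H413.K2E1ChiSectionSpaceU3PairDefs
open scoped ENNReal NNReal

namespace Summit.HodgeConjecture.HodgeConjecture.R90.S8

variable (L : Type) [Field L] [NumberField L] [IsCMField L]
  (μ : Measure (quasiSplit (↥(maximalRealSubfield L)) L (IsCMField.complexConj L) 3).automorphicQuotient)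

/-! ## §1 Finite linearity of the Eisenstein sum; `L²` classes of finite combinations -/

/-- **`E(Σᵢ aᵢ Φᵢ)(x) = Σᵢ aᵢ E(Φᵢ)(x)`** when every `E(Φᵢ)` converges absolutely at `x` (★ `eisensteinSeriesU_add`, `eisensteinSeriesU_smul`, Finset induction). [cite: MoeglinWaldspurger1995, II.1.5] -/
theorem eisensteinSeriesU_finset_sum {ι : Type*} (s : Finset ι) (a : ι → ℂ) (Φ : ι → (quasiSplit (↥(maximalRealSubfield L)) L (IsCMField.complexConj L) 3).Adelic → ℂ) (x : (quasiSplit (↥(maximalRealSubfield L)) L (IsCMField.complexConj L) 3).Adelic)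
    (hs : ∀ i ∈ s, Summable fun q : Quotient (MulAction.orbitRel ↥(borelU ((IsCMField.complexConj L : L ≃ₐ[↥(maximalRealSubfield L)] L) : L →+* L) ((StdForm.antidiagonal 3).over L)) ↥(unitaryGroupOfForm ((IsCMField.complexConj L : L ≃ₐ[↥(maximalRealSubfield L)] L) : L →+* L) ((StdForm.antidiagonal 3).over L))) => Φ i ((quasiSplit (↥(maximalRealSubfield L)) L (IsCMField.complexConj L) 3).toAdelic (Quotient.out q : ↥(unitaryGroupOfForm ((IsCMField.complexConj L : L ≃ₐ[↥(maximalRealSubfield L)] L) : L →+* L) ((StdForm.antidiagonal 3).over L))) * x)) :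
    eisensteinSeriesU (∑ i ∈ s, a i • Φ i) x = ∑ i ∈ s, a i * eisensteinSeriesU (Φ i) x := by
  classical
  induction s using Finset.induction_on with
  | empty => simp only [Finset.sum_empty, eisensteinSeriesU_zero]
  | insert i s hi ih =>
    rw [Finset.sum_insert hi, Finset.sum_insert hi]
    have h1 : Summable fun q : Quotient (MulAction.orbitRel ↥(borelU ((IsCMField.complexConj L : L ≃ₐ[↥(maximalRealSubfield L)] L) : L →+* L) ((StdForm.antidiagonal 3).over L)) ↥(unitaryGroupOfForm ((IsCMField.complexConj L : L ≃ₐ[↥(maximalRealSubfield L)] L) : L →+* L) ((StdForm.antidiagonal 3).over L))) => (a i • Φ i) ((quasiSplit (↥(maximalRealSubfield L)) L (IsCMField.complexConj L) 3).toAdelic (Quotient.out q : ↥(unitaryGroupOfForm ((IsCMField.complexConj L : L ≃ₐ[↥(maximalRealSubfield L)] L) : L →+* L) ((StdForm.antidiagonal 3).over L))) * x) := ((hs i (Finset.mem_insert_self i s)).mul_left (a i)).congr fun q => by simp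
    have h2 : Summable fun q : Quotient (MulAction.orbitRel ↥(borelU ((IsCMField.complexConj L : L ≃ₐ[↥(maximalRealSubfield L)] L) : L →+* L) ((StdForm.antidiagonal 3).over L)) ↥(unitaryGroupOfForm ((IsCMField.complexConj L : L ≃ₐ[↥(maximalRealSubfield L)] L) : L →+* L) ((StdForm.antidiagonal 3).over L))) => (∑ j ∈ s, a j • Φ j) ((quasiSplit (↥(maximalRealSubfield L)) L (IsCMField.complexConj L) 3).toAdelic (Quotient.out q : ↥(unitaryGroupOfForm ((IsCMField.complexConj L : L ≃ₐ[↥(maximalRealSubfield L)] L) : L →+* L) ((StdForm.antidiagonal 3).over L))) * x) := by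
      have h := summable_sum fun j hj => (hs j (Finset.mem_insert_of_mem hj)).mul_left (a j)
      refine h.congr fun q => ?_
      simp only [Finset.sum_apply, Pi.smul_apply, smul_eq_mul]
    rw [eisensteinSeriesU_add h1 h2, eisensteinSeriesU_smul, ih fun j hj => hs j (Finset.mem_insert_of_mem hj)]

/-- **The `L²` class of a finite combination is a.e. the combination of the classes** (`Lp.coeFn_add`, `Lp.coeFn_smul`, Finset induction). [folklore] -/
theorem coeFn_finset_sum_smul_ae {ι : Type*} (s : Finset ι) (a : ι → ℂ) (f : ι → (quasiSplit (↥(maximalRealSubfield L)) L (IsCMField.complexConj L) 3).L2 μ) :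
    ((∑ i ∈ s, a i • f i : (quasiSplit (↥(maximalRealSubfield L)) L (IsCMField.complexConj L) 3).L2 μ) : (quasiSplit (↥(maximalRealSubfield L)) L (IsCMField.complexConj L) 3).automorphicQuotient → ℂ) =ᵐ[μ] fun x => ∑ i ∈ s, a i * (f i : (quasiSplit (↥(maximalRealSubfield L)) L (IsCMField.complexConj L) 3).automorphicQuotient → ℂ) x := by
  classical
  induction s using Finset.induction_on with
  | empty =>
    filter_upwards [Lp.coeFn_zero (E := ℂ) (p := 2) (μ := μ)] with x hx
    simp only [Finset.sum_empty]
    exact hx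
  | insert i s hi ih =>
    rw [Finset.sum_insert hi]
    filter_upwards [Lp.coeFn_add (a i • f i) (∑ j ∈ s, a j • f j), Lp.coeFn_smul (a i) (f i), ih] with x hadd hsmul hih
    rw [hadd, Pi.add_apply, hsmul, Pi.smul_apply, smul_eq_mul, hih, Finset.sum_insert hi]

/-! ## §2 The residue identity along a finite flat re-expansion, and `R(g) f = Σᵢ cᵢ^{3/2} fᵢ` -/

section Main

variable [(quasiSplit (↥(maximalRealSubfield L)) L (IsCMField.complexConj L) 3).IsAutomorphicMeasure μ] (ξ : OneDimAutRepH L) (μω : HeckeCharacter L)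

/-- **THE POINTWISE RESIDUE IDENTITY `Fp (x·g) (3∕2) = Σᵢ cᵢ^{3/2} · Fpᵢ x (3∕2)`** along a finite flat re-expansion `flat(φ,z)(x g) = Σᵢ cᵢ^z flat(ψᵢ,z)(x)` (`cᵢ > 0`), for
sections `φ` and `ψᵢ` in the level-free section space with continuation data: the module docstring's steps (a)–(c).  `μω` unitary feeds ★ `hSUM_holds` (Godement summability of every
`flat(ψᵢ, z)`, `2 < Re z`). [cite: MoeglinWaldspurger1995, II.1.5, IV.1.11] [cite: Conway1978, IV §3] -/
theorem midPoleLetter_translate_eq_sum (hμu : μω.IsUnitary)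
    {φ : (quasiSplit (↥(maximalRealSubfield L)) L (IsCMField.complexConj L) 3).Adelic → ℂ} (Ec : ℂ → (quasiSplit (↥(maximalRealSubfield L)) L (IsCMField.complexConj L) 3).Adelic → ℂ) (Sp : Finset ℂ) (hSp : ∀ s ∈ Sp, s.im = 0 ∧ 1 < s.re ∧ s.re ≤ 2)
      (hol : ∀ g, DifferentiableOn ℂ (fun z => Ec z g) ({z : ℂ | 1 < z.re} \ (↑Sp : Set ℂ)))
      (hEc : ∀ z : ℂ, 2 < z.re → Ec z = eisensteinSeriesU (flatSectionU φ z))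
      (Fp : (quasiSplit (↥(maximalRealSubfield L)) L (IsCMField.complexConj L) 3).Adelic → ℂ → ℂ) (hF : ∀ g, AnalyticAt ℂ (Fp g) ((3 : ℂ) / 2))
      (hFE : ∀ g, Fp g =ᶠ[𝓝[≠] ((3 : ℂ) / 2)] fun z => (z - (3 : ℂ) / 2) * Ec z g)
    (g : (quasiSplit (↥(maximalRealSubfield L)) L (IsCMField.complexConj L) 3).Adelic) {ι : Type*} (s : Finset ι) (c : ι → ℝ≥0) (hc : ∀ i ∈ s, 0 < c i)
    (ψ : ι → (quasiSplit (↥(maximalRealSubfield L)) L (IsCMField.complexConj L) 3).Adelic → ℂ)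
    (hψ : ∀ i ∈ s, ψ i ∈ chiSectionSpacePair (ξ.bcη⁻¹ * ξ.bcψ⁻¹ * μω) ξ.ψ (⊥ : Subgroup (quasiSplit (↥(maximalRealSubfield L)) L (IsCMField.complexConj L) 3).Adelic) ((1 : ↥(⊥ : Subgroup (quasiSplit (↥(maximalRealSubfield L)) L (IsCMField.complexConj L) 3).Adelic) →* ℂ) : ↥(⊥ : Subgroup (quasiSplit (↥(maximalRealSubfield L)) L (IsCMField.complexConj L) 3).Adelic) → ℂ))
    (hψc : ∀ i ∈ s, Continuous (ψ i))
    (Ecι : ι → ℂ → (quasiSplit (↥(maximalRealSubfield L)) L (IsCMField.complexConj L) 3).Adelic → ℂ) (Spι : ι → Finset ℂ) (hSpι : ∀ i ∈ s, ∀ t ∈ Spι i, t.im = 0 ∧ 1 < t.re ∧ t.re ≤ 2)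
    (holι : ∀ i ∈ s, ∀ y, DifferentiableOn ℂ (fun z => Ecι i z y) ({z : ℂ | 1 < z.re} \ (↑(Spι i) : Set ℂ)))
    (hEcι : ∀ i ∈ s, ∀ z : ℂ, 2 < z.re → Ecι i z = eisensteinSeriesU (flatSectionU (ψ i) z))
    (Fpι : ι → (quasiSplit (↥(maximalRealSubfield L)) L (IsCMField.complexConj L) 3).Adelic → ℂ → ℂ) (hFι : ∀ i ∈ s, ∀ y, AnalyticAt ℂ (Fpι i y) ((3 : ℂ) / 2))
    (hFEι : ∀ i ∈ s, ∀ y, Fpι i y =ᶠ[𝓝[≠] ((3 : ℂ) / 2)] fun z => (z - (3 : ℂ) / 2) * Ecι i z y)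
    (hdec : ∀ (z : ℂ) (x : (quasiSplit (↥(maximalRealSubfield L)) L (IsCMField.complexConj L) 3).Adelic), flatSectionU φ z (x * g) = ∑ i ∈ s, (((c i : ℝ) : ℂ) ^ z) * flatSectionU (ψ i) z x)
    (x : (quasiSplit (↥(maximalRealSubfield L)) L (IsCMField.complexConj L) 3).Adelic) :
    Fp (x * g) ((3 : ℂ) / 2) = ∑ i ∈ s, (((c i : ℝ) : ℂ) ^ ((3 : ℂ) / 2)) * Fpι i x ((3 : ℂ) / 2) := by
  classical
  -- (a) on the Godement half-plane: `Ec z (x g) = Σᵢ cᵢ^z Ecᵢ z x`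
  have hsumψ : ∀ i ∈ s, ∀ z : ℂ, 2 < z.re → Summable fun q : Quotient (MulAction.orbitRel ↥(borelU ((IsCMField.complexConj L : L ≃ₐ[↥(maximalRealSubfield L)] L) : L →+* L) ((StdForm.antidiagonal 3).over L)) ↥(unitaryGroupOfForm ((IsCMField.complexConj L : L ≃ₐ[↥(maximalRealSubfield L)] L) : L →+* L) ((StdForm.antidiagonal 3).over L))) => flatSectionU (ψ i) z ((quasiSplit (↥(maximalRealSubfield L)) L (IsCMField.complexConj L) 3).toAdelic (Quotient.out q : ↥(unitaryGroupOfForm ((IsCMField.complexConj L : L ≃ₐ[↥(maximalRealSubfield L)] L) : L →+* L) ((StdForm.antidiagonal 3).over L))) * x) := fun i hi z hz =>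
    (hSUM_of_unitary L ξ μω hμu (norm_eta_apply_eq_one L ξ) (norm_psi_apply_eq_one L ξ) (ψ i) (hψ i hi) (hψc i hi) z hz x).of_norm
  have hgod : ∀ z : ℂ, 2 < z.re → Ec z (x * g) = ∑ i ∈ s, (((c i : ℝ) : ℂ) ^ z) * Ecι i z x := by
    intro z hz
    have hre : rightTranslation (quasiSplit (↥(maximalRealSubfield L)) L (IsCMField.complexConj L) 3) g (flatSectionU φ z) = ∑ i ∈ s, (((c i : ℝ) : ℂ) ^ z) • flatSectionU (ψ i) z := by
      funext y
      rw [rightTranslation_apply, hdec z y, Finset.sum_apply]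
      simp only [Pi.smul_apply, smul_eq_mul]
    rw [hEc z hz, ← eisensteinSeriesU_rightTranslation L (flatSectionU φ z) g x, hre, eisensteinSeriesU_finset_sum L s _ _ x (fun i hi => hsumψ i hi z hz)]
    exact Finset.sum_congr rfl fun i hi => by rw [hEcι i hi z hz]
  -- (b) both sides are holomorphic on the slit half-plane off the union of the real slits, so they agree there
  set S : Set ℂ := (↑(Sp ∪ s.biUnion Spι) : Set ℂ) with hSdef
  have hSreal : ∀ t ∈ S, t.im = 0 := by
    intro t ht
    rcases Finset.mem_union.1 (Finset.mem_coe.1 ht) with h | h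
    · exact (hSp t h).1
    · obtain ⟨i, hi, hti⟩ := Finset.mem_biUnion.1 h
      exact (hSpι i hi t hti).1
  have hSclosed : IsClosed S := (Sp ∪ s.biUnion Spι).finite_toSet.isClosed
  have hsubL : ({z : ℂ | 1 < z.re} \ S) ⊆ {z : ℂ | 1 < z.re} \ (↑Sp : Set ℂ) :=
    Set.sdiff_subset_sdiff_right (Finset.coe_subset.2 Finset.subset_union_left)
  have hsubR : ∀ i ∈ s, ({z : ℂ | 1 < z.re} \ S) ⊆ {z : ℂ | 1 < z.re} \ (↑(Spι i) : Set ℂ) := fun i hi =>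
    Set.sdiff_subset_sdiff_right (Finset.coe_subset.2 ((Finset.subset_biUnion_of_mem Spι hi).trans Finset.subset_union_right))
  have holL : DifferentiableOn ℂ (fun z => Ec z (x * g)) ({z : ℂ | 1 < z.re} \ S) := (hol (x * g)).mono hsubL
  have holR : DifferentiableOn ℂ (fun z => ∑ i ∈ s, (((c i : ℝ) : ℂ) ^ z) * Ecι i z x) ({z : ℂ | 1 < z.re} \ S) := by
    refine DifferentiableOn.fun_sum fun i hi => ?_
    have hci : ((c i : ℝ) : ℂ) ≠ 0 := by exact_mod_cast (hc i hi).ne'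
    have hd : Differentiable ℂ (fun z : ℂ => ((c i : ℝ) : ℂ) ^ z) := fun z => differentiableAt_id.const_cpow (Or.inl hci)
    exact hd.differentiableOn.mul ((holι i hi x).mono (hsubR i hi))
  have hagree : EqOn (fun z => Ec z (x * g)) (fun z => ∑ i ∈ s, (((c i : ℝ) : ℂ) ^ z) * Ecι i z x) ({z : ℂ | 1 < z.re} \ S) :=
    eqOn_reSlit_of_eqOn_re_gt hSreal hSclosed holL holR hgod
  -- (c) the pole letters at `3∕2`
  have hFsum : AnalyticAt ℂ (fun z => ∑ i ∈ s, (((c i : ℝ) : ℂ) ^ z) * Fpι i x z) ((3 : ℂ) / 2) := by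
    refine Finset.analyticAt_fun_sum s fun i hi => ?_
    have hci : ((c i : ℝ) : ℂ) ≠ 0 := by exact_mod_cast (hc i hi).ne'
    have hd : Differentiable ℂ (fun z : ℂ => ((c i : ℝ) : ℂ) ^ z) := fun z => differentiableAt_id.const_cpow (Or.inl hci)
    exact (hd.analyticAt _).mul (hFι i hi x)
  have hFEsum : (fun z => ∑ i ∈ s, (((c i : ℝ) : ℂ) ^ z) * Fpι i x z) =ᶠ[𝓝[≠] ((3 : ℂ) / 2)]
      fun z => (z - (3 : ℂ) / 2) * ∑ i ∈ s, (((c i : ℝ) : ℂ) ^ z) * Ecι i z x := by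
    have hall : ∀ᶠ z in 𝓝[≠] ((3 : ℂ) / 2), ∀ i ∈ s, Fpι i x z = (z - (3 : ℂ) / 2) * Ecι i z x :=
      (s.eventually_all).2 fun i hi => hFEι i hi x
    filter_upwards [hall] with z hz
    rw [Finset.mul_sum]
    exact Finset.sum_congr rfl fun i hi => by rw [hz i hi]; ring
  -- the slit domain is eventually everything along `𝓝[≠] 3∕2` restricted to the upper quadrant; frequent agreement suffices
  have hfreq : ∃ᶠ z in 𝓝[≠] ((3 : ℂ) / 2), Ec z (x * g) = ∑ i ∈ s, (((c i : ℝ) : ℂ) ^ z) * Ecι i z x :=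
    (frequently_nhdsNE_re_gt_im_pos (show (1 : ℝ) ≤ ((3 : ℂ) / 2).re by norm_num) (show ((3 : ℂ) / 2).im = 0 by norm_num)).mono fun w hw =>
      hagree ⟨hw.1, fun hwS => hw.2.ne' (hSreal w hwS)⟩
  exact poleLetter_apply_eq_of_frequently_eq (hF (x * g)) hFsum (hFE (x * g)) hFEsum hfreq

/-- **`R(g) f = Σᵢ cᵢ^{3/2} • fᵢ` IN `L²`** along a finite flat re-expansion: `R(g) f` is a.e. `x ↦ Fp((out x)⁻¹·g)(3∕2)` (★ `rightRegular_apply_coeFn`, ★ `quotFun_rightTranslation` with the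
left-`G(F)`-invariance of the residue function ★ `midPoleLetter_apply_quotientSubgroup_mul`), the previous theorem rewrites it pointwise, and the classes `fᵢ` are a.e. the residue functions of
the `ψᵢ`. [cite: MoeglinWaldspurger1995, II.1.5, IV.1.11, V.3.13] -/
theorem rightRegular_apply_eq_sum_of_flatReexpansion (hμu : μω.IsUnitary)
    {φ : (quasiSplit (↥(maximalRealSubfield L)) L (IsCMField.complexConj L) 3).Adelic → ℂ} (hφ : φ ∈ chiSectionSpacePair (ξ.bcη⁻¹ * ξ.bcψ⁻¹ * μω) ξ.ψ (⊥ : Subgroup (quasiSplit (↥(maximalRealSubfield L)) L (IsCMField.complexConj L) 3).Adelic) ((1 : ↥(⊥ : Subgroup (quasiSplit (↥(maximalRealSubfield L)) L (IsCMField.complexConj L) 3).Adelic) →* ℂ) : ↥(⊥ : Subgroup (quasiSplit (↥(maximalRealSubfield L)) L (IsCMField.complexConj L) 3).Adelic) → ℂ))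
    (Ec : ℂ → (quasiSplit (↥(maximalRealSubfield L)) L (IsCMField.complexConj L) 3).Adelic → ℂ) (Sp : Finset ℂ) (hSp : ∀ s ∈ Sp, s.im = 0 ∧ 1 < s.re ∧ s.re ≤ 2)
      (hol : ∀ g, DifferentiableOn ℂ (fun z => Ec z g) ({z : ℂ | 1 < z.re} \ (↑Sp : Set ℂ)))
      (hEc : ∀ z : ℂ, 2 < z.re → Ec z = eisensteinSeriesU (flatSectionU φ z))
      (Fp : (quasiSplit (↥(maximalRealSubfield L)) L (IsCMField.complexConj L) 3).Adelic → ℂ → ℂ) (hF : ∀ g, AnalyticAt ℂ (Fp g) ((3 : ℂ) / 2))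
      (hFE : ∀ g, Fp g =ᶠ[𝓝[≠] ((3 : ℂ) / 2)] fun z => (z - (3 : ℂ) / 2) * Ec z g)
    {f : (quasiSplit (↥(maximalRealSubfield L)) L (IsCMField.complexConj L) 3).L2 μ} (hae : (f : (quasiSplit (↥(maximalRealSubfield L)) L (IsCMField.complexConj L) 3).automorphicQuotient → ℂ) =ᵐ[μ] fun x => Fp (Quotient.out (x : ((quasiSplit (↥(maximalRealSubfield L)) L (IsCMField.complexConj L) 3).Adelic ⧸ (quasiSplit (↥(maximalRealSubfield L)) L (IsCMField.complexConj L) 3).quotientSubgroup)))⁻¹ ((3 : ℂ) / 2))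
    (g : (quasiSplit (↥(maximalRealSubfield L)) L (IsCMField.complexConj L) 3).Adelic) {ι : Type*} (s : Finset ι) (c : ι → ℝ≥0) (hc : ∀ i ∈ s, 0 < c i)
    (ψ : ι → (quasiSplit (↥(maximalRealSubfield L)) L (IsCMField.complexConj L) 3).Adelic → ℂ) (hψ : ∀ i ∈ s, ψ i ∈ chiSectionSpacePair (ξ.bcη⁻¹ * ξ.bcψ⁻¹ * μω) ξ.ψ (⊥ : Subgroup (quasiSplit (↥(maximalRealSubfield L)) L (IsCMField.complexConj L) 3).Adelic) ((1 : ↥(⊥ : Subgroup (quasiSplit (↥(maximalRealSubfield L)) L (IsCMField.complexConj L) 3).Adelic) →* ℂ) : ↥(⊥ : Subgroup (quasiSplit (↥(maximalRealSubfield L)) L (IsCMField.complexConj L) 3).Adelic) → ℂ))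
    (hψc : ∀ i ∈ s, Continuous (ψ i))
    (Ecι : ι → ℂ → (quasiSplit (↥(maximalRealSubfield L)) L (IsCMField.complexConj L) 3).Adelic → ℂ) (Spι : ι → Finset ℂ) (hSpι : ∀ i ∈ s, ∀ t ∈ Spι i, t.im = 0 ∧ 1 < t.re ∧ t.re ≤ 2)
    (holι : ∀ i ∈ s, ∀ y, DifferentiableOn ℂ (fun z => Ecι i z y) ({z : ℂ | 1 < z.re} \ (↑(Spι i) : Set ℂ)))
    (hEcι : ∀ i ∈ s, ∀ z : ℂ, 2 < z.re → Ecι i z = eisensteinSeriesU (flatSectionU (ψ i) z))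
    (Fpι : ι → (quasiSplit (↥(maximalRealSubfield L)) L (IsCMField.complexConj L) 3).Adelic → ℂ → ℂ) (hFι : ∀ i ∈ s, ∀ y, AnalyticAt ℂ (Fpι i y) ((3 : ℂ) / 2))
    (hFEι : ∀ i ∈ s, ∀ y, Fpι i y =ᶠ[𝓝[≠] ((3 : ℂ) / 2)] fun z => (z - (3 : ℂ) / 2) * Ecι i z y)
    (fι : ι → (quasiSplit (↥(maximalRealSubfield L)) L (IsCMField.complexConj L) 3).L2 μ) (haeι : ∀ i ∈ s, ((fι i : (quasiSplit (↥(maximalRealSubfield L)) L (IsCMField.complexConj L) 3).L2 μ) : (quasiSplit (↥(maximalRealSubfield L)) L (IsCMField.complexConj L) 3).automorphicQuotient → ℂ) =ᵐ[μ] fun x => Fpι i (Quotient.out (x : ((quasiSplit (↥(maximalRealSubfield L)) L (IsCMField.complexConj L) 3).Adelic ⧸ (quasiSplit (↥(maximalRealSubfield L)) L (IsCMField.complexConj L) 3).quotientSubgroup)))⁻¹ ((3 : ℂ) / 2))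
    (hdec : ∀ (z : ℂ) (x : (quasiSplit (↥(maximalRealSubfield L)) L (IsCMField.complexConj L) 3).Adelic), flatSectionU φ z (x * g) = ∑ i ∈ s, (((c i : ℝ) : ℂ) ^ z) * flatSectionU (ψ i) z x) :
    ((quasiSplit (↥(maximalRealSubfield L)) L (IsCMField.complexConj L) 3).rightRegular μ) g f = ∑ i ∈ s, (((c i : ℝ) : ℂ) ^ ((3 : ℂ) / 2)) • fι i := by
  classical
  -- the translated class is a.e. the translated residue function (★ p863205 §3's three lines)
  have hinv : ∀ γ ∈ (quasiSplit (↥(maximalRealSubfield L)) L (IsCMField.complexConj L) 3).quotientSubgroup, ∀ y : (quasiSplit (↥(maximalRealSubfield L)) L (IsCMField.complexConj L) 3).Adelic,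
      (fun y : (quasiSplit (↥(maximalRealSubfield L)) L (IsCMField.complexConj L) 3).Adelic => Fp y ((3 : ℂ) / 2)) (γ * y) = (fun y : (quasiSplit (↥(maximalRealSubfield L)) L (IsCMField.complexConj L) 3).Adelic => Fp y ((3 : ℂ) / 2)) y :=
    midPoleLetter_apply_quotientSubgroup_mul L (isChiSectionPair_of_mem hφ) ξ.hψ (fun t ht => (hSp t ht).1) hol hEc (by norm_num) (by norm_num) hF hFE
  have h3 := AdelicGroupData.quotFun_rightTranslation (φ := fun y : (quasiSplit (↥(maximalRealSubfield L)) L (IsCMField.complexConj L) 3).Adelic => Fp y ((3 : ℂ) / 2)) hinv g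
  have h1 := (quasiSplit (↥(maximalRealSubfield L)) L (IsCMField.complexConj L) 3).rightRegular_apply_coeFn μ g f
  have h2 := (measurePreserving_smul g⁻¹ μ).quasiMeasurePreserving.ae_eq_comp hae
  have hRg : ((((quasiSplit (↥(maximalRealSubfield L)) L (IsCMField.complexConj L) 3).rightRegular μ) g f : (quasiSplit (↥(maximalRealSubfield L)) L (IsCMField.complexConj L) 3).L2 μ) : (quasiSplit (↥(maximalRealSubfield L)) L (IsCMField.complexConj L) 3).automorphicQuotient → ℂ) =ᵐ[μ]
      fun x => (fun y : (quasiSplit (↥(maximalRealSubfield L)) L (IsCMField.complexConj L) 3).Adelic => Fp (y * g)) (Quotient.out (x : ((quasiSplit (↥(maximalRealSubfield L)) L (IsCMField.complexConj L) 3).Adelic ⧸ (quasiSplit (↥(maximalRealSubfield L)) L (IsCMField.complexConj L) 3).quotientSubgroup)))⁻¹ ((3 : ℂ) / 2) :=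
    h1.trans (h2.trans (Filter.Eventually.of_forall fun x => (congrFun h3 x).symm))
  -- pointwise residue identity and the a.e. classes of the pieces
  have hall : ∀ᵐ x ∂μ, ∀ i ∈ s, ((fι i : (quasiSplit (↥(maximalRealSubfield L)) L (IsCMField.complexConj L) 3).L2 μ) : (quasiSplit (↥(maximalRealSubfield L)) L (IsCMField.complexConj L) 3).automorphicQuotient → ℂ) x = Fpι i (Quotient.out (x : ((quasiSplit (↥(maximalRealSubfield L)) L (IsCMField.complexConj L) 3).Adelic ⧸ (quasiSplit (↥(maximalRealSubfield L)) L (IsCMField.complexConj L) 3).quotientSubgroup)))⁻¹ ((3 : ℂ) / 2) :=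
    (s.eventually_all).2 fun i hi => haeι i hi
  have hcl := coeFn_finset_sum_smul_ae L μ s (fun i => ((c i : ℝ) : ℂ) ^ ((3 : ℂ) / 2)) fι
  refine Lp.ext ?_
  filter_upwards [hRg, hall, hcl] with x h1 h2 h3
  rw [h1, h3]
  show Fp ((Quotient.out (x : _ ⧸ _))⁻¹ * g) ((3 : ℂ) / 2) = ∑ i ∈ s, (((c i : ℝ) : ℂ) ^ ((3 : ℂ) / 2)) * ((fι i : _) : _ → ℂ) x
  rw [midPoleLetter_translate_eq_sum L ξ μω hμu Ec Sp hSp hol hEc Fp hF hFE g s c hc ψ hψ hψc Ecι Spι hSpι holι hEcι Fpι hFι hFEι hdec _]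
  exact Finset.sum_congr rfl fun i hi => by rw [h2 i hi]

/-- **`R(g) f ∈ span G_τ`** when the pieces `fᵢ` are τ-admissible generators (at τ-levels `U i`): the finite-adelic half of `hTRANSτ` for `f`, modulo the re-expansion (FILE A) and the exports
of the pieces (ESTATE T). [cite: MoeglinWaldspurger1995, II.1, V.3.13] -/
theorem rightRegular_apply_mem_span_tauGenerators_of_flatReexpansion (hμu : μω.IsUnitary)
    {φ : (quasiSplit (↥(maximalRealSubfield L)) L (IsCMField.complexConj L) 3).Adelic → ℂ} (hφ : φ ∈ chiSectionSpacePair (ξ.bcη⁻¹ * ξ.bcψ⁻¹ * μω) ξ.ψ (⊥ : Subgroup (quasiSplit (↥(maximalRealSubfield L)) L (IsCMField.complexConj L) 3).Adelic) ((1 : ↥(⊥ : Subgroup (quasiSplit (↥(maximalRealSubfield L)) L (IsCMField.complexConj L) 3).Adelic) →* ℂ) : ↥(⊥ : Subgroup (quasiSplit (↥(maximalRealSubfield L)) L (IsCMField.complexConj L) 3).Adelic) → ℂ))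
    (Ec : ℂ → (quasiSplit (↥(maximalRealSubfield L)) L (IsCMField.complexConj L) 3).Adelic → ℂ) (Sp : Finset ℂ) (hSp : ∀ s ∈ Sp, s.im = 0 ∧ 1 < s.re ∧ s.re ≤ 2)
      (hol : ∀ g, DifferentiableOn ℂ (fun z => Ec z g) ({z : ℂ | 1 < z.re} \ (↑Sp : Set ℂ)))
      (hEc : ∀ z : ℂ, 2 < z.re → Ec z = eisensteinSeriesU (flatSectionU φ z))
      (Fp : (quasiSplit (↥(maximalRealSubfield L)) L (IsCMField.complexConj L) 3).Adelic → ℂ → ℂ) (hF : ∀ g, AnalyticAt ℂ (Fp g) ((3 : ℂ) / 2))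
      (hFE : ∀ g, Fp g =ᶠ[𝓝[≠] ((3 : ℂ) / 2)] fun z => (z - (3 : ℂ) / 2) * Ec z g)
    {f : (quasiSplit (↥(maximalRealSubfield L)) L (IsCMField.complexConj L) 3).L2 μ} (hae : (f : (quasiSplit (↥(maximalRealSubfield L)) L (IsCMField.complexConj L) 3).automorphicQuotient → ℂ) =ᵐ[μ] fun x => Fp (Quotient.out (x : ((quasiSplit (↥(maximalRealSubfield L)) L (IsCMField.complexConj L) 3).Adelic ⧸ (quasiSplit (↥(maximalRealSubfield L)) L (IsCMField.complexConj L) 3).quotientSubgroup)))⁻¹ ((3 : ℂ) / 2))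
    (g : (quasiSplit (↥(maximalRealSubfield L)) L (IsCMField.complexConj L) 3).Adelic) {ι : Type*} (s : Finset ι) (c : ι → ℝ≥0) (hc : ∀ i ∈ s, 0 < c i)
    (ψ : ι → (quasiSplit (↥(maximalRealSubfield L)) L (IsCMField.complexConj L) 3).Adelic → ℂ) (hψ : ∀ i ∈ s, ψ i ∈ chiSectionSpacePair (ξ.bcη⁻¹ * ξ.bcψ⁻¹ * μω) ξ.ψ (⊥ : Subgroup (quasiSplit (↥(maximalRealSubfield L)) L (IsCMField.complexConj L) 3).Adelic) ((1 : ↥(⊥ : Subgroup (quasiSplit (↥(maximalRealSubfield L)) L (IsCMField.complexConj L) 3).Adelic) →* ℂ) : ↥(⊥ : Subgroup (quasiSplit (↥(maximalRealSubfield L)) L (IsCMField.complexConj L) 3).Adelic) → ℂ))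
    (hψc : ∀ i ∈ s, Continuous (ψ i))
    (Ecι : ι → ℂ → (quasiSplit (↥(maximalRealSubfield L)) L (IsCMField.complexConj L) 3).Adelic → ℂ) (Spι : ι → Finset ℂ) (hSpι : ∀ i ∈ s, ∀ t ∈ Spι i, t.im = 0 ∧ 1 < t.re ∧ t.re ≤ 2)
    (holι : ∀ i ∈ s, ∀ y, DifferentiableOn ℂ (fun z => Ecι i z y) ({z : ℂ | 1 < z.re} \ (↑(Spι i) : Set ℂ)))
    (hEcι : ∀ i ∈ s, ∀ z : ℂ, 2 < z.re → Ecι i z = eisensteinSeriesU (flatSectionU (ψ i) z))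
    (Fpι : ι → (quasiSplit (↥(maximalRealSubfield L)) L (IsCMField.complexConj L) 3).Adelic → ℂ → ℂ) (hFι : ∀ i ∈ s, ∀ y, AnalyticAt ℂ (Fpι i y) ((3 : ℂ) / 2))
    (hFEι : ∀ i ∈ s, ∀ y, Fpι i y =ᶠ[𝓝[≠] ((3 : ℂ) / 2)] fun z => (z - (3 : ℂ) / 2) * Ecι i z y)
    (fι : ι → (quasiSplit (↥(maximalRealSubfield L)) L (IsCMField.complexConj L) 3).L2 μ) (haeι : ∀ i ∈ s, ((fι i : (quasiSplit (↥(maximalRealSubfield L)) L (IsCMField.complexConj L) 3).L2 μ) : (quasiSplit (↥(maximalRealSubfield L)) L (IsCMField.complexConj L) 3).automorphicQuotient → ℂ) =ᵐ[μ] fun x => Fpι i (Quotient.out (x : ((quasiSplit (↥(maximalRealSubfield L)) L (IsCMField.complexConj L) 3).Adelic ⧸ (quasiSplit (↥(maximalRealSubfield L)) L (IsCMField.complexConj L) 3).quotientSubgroup)))⁻¹ ((3 : ℂ) / 2))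
    (hdec : ∀ (z : ℂ) (x : (quasiSplit (↥(maximalRealSubfield L)) L (IsCMField.complexConj L) 3).Adelic), flatSectionU φ z (x * g) = ∑ i ∈ s, (((c i : ℝ) : ℂ) ^ z) * flatSectionU (ψ i) z x)
    (U : ι → Subgroup ↥(finAdelic (↥(maximalRealSubfield L)) L (IsCMField.complexConj L) 3 ((StdForm.antidiagonal 3).over L))) (hU : ∀ i ∈ s, IsTauLevel L (U i)) (hfι : ∀ i ∈ s, fι i ∈ resGMidAtomGenτ L μ ξ μω (U i)) :
    ((quasiSplit (↥(maximalRealSubfield L)) L (IsCMField.complexConj L) 3).rightRegular μ) g f ∈ Submodule.span ℂ (⋃ (U₀ : Subgroup ↥(finAdelic (↥(maximalRealSubfield L)) L (IsCMField.complexConj L) 3 ((StdForm.antidiagonal 3).over L))) (_ : IsTauLevel L U₀), resGMidAtomGenτ L μ ξ μω U₀) := by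
  rw [rightRegular_apply_eq_sum_of_flatReexpansion L μ ξ μω hμu hφ Ec Sp hSp hol hEc Fp hF hFE hae g s c hc ψ hψ hψc Ecι Spι hSpι holι hEcι Fpι hFι hFEι fι haeι hdec]
  exact Submodule.sum_mem _ fun i hi => Submodule.smul_mem _ _ (Submodule.subset_span
    (Set.mem_iUnion.2 ⟨U i, Set.mem_iUnion.2 ⟨hU i hi, hfι i hi⟩⟩))

end Main

end Summit.HodgeConjecture.HodgeConjecture.R90.S8

end
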